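import Summits.QuantumFields.BalabanUV.T4Continuum.Support.NE7K1LinBlochDenominatorFat

/-!
# NE7K1LinStripClassKLConsts — row NE7 (node U5), candidate route HOM, path H1L, cell K1-lin(s): NEEDS-ESTIMATE #E1, R-E1 TRANCHE B —
# THE CLASS CONSTANTS OF THE SCALED BLOCK-MEAN MULTIPLIER, IN `d` ALONE: radius `r_K(d) = κ_F(d)·c_F(d)∕(32(d+1))`, floor constant
# `C_K(d) = 4(16d∕c_F)∕κ_F²`, fat bound `C_up,K(d) = 16d∕c_F(d)`, and their admissibility `16·C_K·d·r_K² ≤ 1`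

Lineage `b2b-balaban-t4-ne7-p2` (CRUX PROVER NE7 #2), generation 76; file 65a (split off file 65 `NE7K1LinStripClassKL` for size).  Elementary
inequalities between the constants of files 47 (`cN`, `LamN`, `kappaN`) and 50 (`cF`, `LamF`, `kappaF`) and the three class constants that
file 65 feeds to `SymbS` ([folklore], real arithmetic only): `cF_le_cN`, `LamN_le_LamF`, **`kappaF_le_kappaN`**, `rK ∕ CK ∕ CupK`, `rK_pos`,
`CK_nonneg`, `CupK_nonneg`, `cF_le_half`, `rK_le` (`r_K ≤ κ_F∕64`), `d_mul_rK_sq_le` (`d·r_K² ≤ κ_F²∕4096`), **`rK_facts`** (`r_K ≤ 1∕4`,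
`2r_K < κ_F`, `2r_K ≤ κ_N`, `d(2r_K)² < κ_F²`, `d(2r_K)² ≤ 1∕16`, `25·d·r_K² ≤ 1`), **`rK_small`** (`16·C_K·d·r_K² = c_F·d²∕(d+1)² ≤ 1`).

HONEST FRAMING: [folklore] arithmetic; nothing of Bałaban's asserted; no `sorry`.  Census only; NE7 NOT PRINTED ∕ NOT PROVED; spine 0∕9; FIXED
FINITE T⁴, rung (B)+1; NOT infinite volume, NOT mass gap, NOT Clay.  HONEST DEPENDENCY: continuum YM on T⁴ ⇐ BetaPertH ∧ nine spine
estimates (0/9 proved); BetaPertH ⇐ (D1) ∧ (D4) ∧ CAP+tail; G-an2-4 gates asym, D1 and NE2/3/4.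
-/

noncomputable section

open Finset Complex Set

namespace Summit.QuantumFields.BalabanUV.T4Continuum.NE7K1LinStripClassKLConsts

open Literature.MathematicalPhysics.QuantumFieldTheory.Balaban1983to89
open Literature.MathematicalPhysics.QuantumFieldTheory.Balaban1983to89.B4Strip
open Literature.MathematicalPhysics.QuantumFieldTheory.Balaban1983to89.B4StripCauchy
open NE7K1LinBlochDenominator NE7K1LinBlochDenominatorFat

variable {d : ℕ}

/-! ### §1 Constants in `d` alone -/

/-- `c_F ≤ c_N` (`1∕4 ≤ 4∕π²`). [folklore] -/
theorem cF_le_cN (d : ℕ) : cF d ≤ cN d := by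
  unfold cF cN
  have hπ := Real.pi_lt_d2
  have hπ0 := Real.pi_pos
  have h1 : (1 / 4 : ℝ) ≤ 4 / Real.pi ^ 2 := by
    rw [div_le_div_iff₀ (by norm_num) (by positivity)]; nlinarith
  have h2 : (1 / 4 : ℝ) ^ d ≤ (4 / Real.pi ^ 2) ^ d := pow_le_pow_left₀ (by norm_num) h1 d
  linarith

/-- `Λ_N ≤ Λ_F` (`Λ_F = 2Λ_N`). [folklore] -/
theorem LamN_le_LamF (d : ℕ) : LamN d ≤ LamF d := by
  unfold LamN LamF
  have hM := MN_pos d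
  have hr := rOf_pos d
  rw [div_le_div_iff₀ hr (by positivity)]
  nlinarith

/-- `κ_F ≤ κ_N` (the fattened strip is the thinner one). [folklore] -/
theorem kappaF_le_kappaN (d : ℕ) : kappaF d ≤ kappaN d := by
  have hr := rOf_pos d
  have hΛ := LamN_nonneg d
  have hΛ' := LamN_le_LamF d
  have hc := cF_le_cN d
  have hcF := cF_pos d
  unfold kappaN
  refine le_min ((kappaF_le d).trans (by linarith)) ?_
  calc kappaF d ≤ cF d / (LamF d * d + 1) := min_le_right _ _
    _ ≤ cN d / (LamN d * d + 1) := by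
        have hd : (0:ℝ) ≤ d := Nat.cast_nonneg d
        have h1 : LamN d * d + 1 ≤ LamF d * d + 1 := by nlinarith
        have h2 : 0 < LamN d * d + 1 := by positivity
        calc cF d / (LamF d * d + 1) ≤ cF d / (LamN d * d + 1) :=
              div_le_div_of_nonneg_left hcF.le h2 h1
          _ ≤ cN d / (LamN d * d + 1) := div_le_div_of_nonneg_right hc h2.le

/-- THE RADIUS `r_K(d) = κ_F(d)·c_F(d)∕(32(d+1))`. [folklore] -/
def rK (d : ℕ) : ℝ := kappaF d * cF d / (32 * ((d : ℝ) + 1))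

/-- THE FLOOR CONSTANT `C_K(d) = 4·(16d∕c_F(d))∕κ_F(d)²` (file 52's `re_kL_scaled_ge_DeltaXir_sub_sq`). [folklore] -/
def CK (d : ℕ) : ℝ := 4 * (16 * d / cF d) / kappaF d ^ 2

/-- THE FAT BOUND `C_up,K(d) = 16d∕c_F(d)`. [folklore] -/
def CupK (d : ℕ) : ℝ := 16 * d / cF d

/-- `r_K > 0`. [folklore] -/
theorem rK_pos (d : ℕ) : 0 < rK d := by
  unfold rK; have := kappaF_pos d; have := cF_pos d; positivity

/-- `C_K ≥ 0`. [folklore] -/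
theorem CK_nonneg (d : ℕ) : 0 ≤ CK d := by
  unfold CK; have := cF_pos d; positivity

/-- `C_up,K ≥ 0`. [folklore] -/
theorem CupK_nonneg (d : ℕ) : 0 ≤ CupK d := by
  unfold CupK; have := cF_pos d; positivity

/-- `c_F ≤ 1∕2`. [folklore] -/
theorem cF_le_half (d : ℕ) : cF d ≤ 1 / 2 := by
  unfold cF
  have : (1 / 4 : ℝ) ^ d ≤ 1 := pow_le_one₀ (by norm_num) (by norm_num)
  linarith

/-- `r_K ≤ κ_F ∕ 64`. [folklore] -/
theorem rK_le (d : ℕ) : rK d ≤ kappaF d / 64 := by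
  unfold rK
  have hκ := kappaF_pos d
  have hc := cF_le_half d
  have hc0 := cF_pos d
  have hd : (0:ℝ) ≤ d := Nat.cast_nonneg d
  rw [div_le_div_iff₀ (by positivity) (by norm_num)]
  nlinarith [mul_le_mul_of_nonneg_left hc hκ.le]

/-- `d·r_K² ≤ κ_F² ∕ 4096`. [folklore] -/
theorem d_mul_rK_sq_le (d : ℕ) : (d : ℝ) * rK d ^ 2 ≤ kappaF d ^ 2 / 4096 := by
  have hκ := kappaF_pos d
  have hc := cF_le_half d
  have hc0 := cF_pos d
  have hd : (0:ℝ) ≤ d := Nat.cast_nonneg d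
  -- `rK ≤ κ_F ∕ (64(d+1))`
  have h1 : rK d ≤ kappaF d / (64 * ((d : ℝ) + 1)) := by
    unfold rK
    rw [div_le_div_iff₀ (by positivity) (by positivity)]
    nlinarith [mul_le_mul_of_nonneg_left hc hκ.le]
  have h2 : rK d ^ 2 ≤ (kappaF d / (64 * ((d : ℝ) + 1))) ^ 2 := pow_le_pow_left₀ (rK_pos d).le h1 2
  have h3 : (d : ℝ) * (kappaF d / (64 * ((d : ℝ) + 1))) ^ 2 ≤ kappaF d ^ 2 / 4096 := by
    rw [div_pow, mul_pow, mul_div_assoc']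
    rw [div_le_div_iff₀ (by positivity) (by norm_num)]
    nlinarith [sq_nonneg (kappaF d), mul_nonneg hd (sq_nonneg (kappaF d))]
  nlinarith [mul_le_mul_of_nonneg_left h2 hd]

/-- the elementary consequences: `r_K ≤ 1∕4`, `2r_K < κ_F`, `2r_K ≤ κ_N`, `d(2r_K)² < κ_F²`, `d(2r_K)² ≤ 1∕16`, `25·d·r_K² ≤ 1`. [folklore] -/
theorem rK_facts (d : ℕ) :
    rK d ≤ 1 / 4 ∧ 2 * rK d < kappaF d ∧ 2 * rK d ≤ kappaN d ∧ (d : ℝ) * (2 * rK d) ^ 2 < kappaF d ^ 2 ∧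
      (d : ℝ) * (2 * rK d) ^ 2 ≤ 1 / 16 ∧ 25 * ((d : ℝ) * rK d ^ 2) ≤ 1 := by
  have hκ := kappaF_pos d
  have hκ8 := kappaF_le_eighth d
  have hκN := kappaF_le_kappaN d
  have h1 := rK_le d
  have h2 := d_mul_rK_sq_le d
  have hr := rK_pos d
  refine ⟨by linarith, by linarith, by linarith, ?_, ?_, ?_⟩
  · nlinarith
  · nlinarith
  · nlinarith

/-- **ADMISSIBILITY**: `16·C_K·d·r_K² ≤ 1` (`= d²c_F∕(d+1)² ≤ c_F ≤ 1∕2`). [folklore] -/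
theorem rK_small (d : ℕ) : 16 * CK d * ((d : ℝ) * rK d ^ 2) ≤ 1 := by
  have hκ := kappaF_pos d
  have hc0 := cF_pos d
  have hc := cF_le_half d
  have hd : (0:ℝ) ≤ d := Nat.cast_nonneg d
  have e : 16 * CK d * ((d : ℝ) * rK d ^ 2) = cF d * ((d : ℝ) / ((d : ℝ) + 1)) ^ 2 := by
    unfold CK rK
    field_simp
    ring
  rw [e]
  have h1 : ((d : ℝ) / ((d : ℝ) + 1)) ^ 2 ≤ 1 := by
    have : (d : ℝ) / ((d : ℝ) + 1) ≤ 1 := by rw [div_le_one (by positivity)]; linarith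
    exact pow_le_one₀ (by positivity) this
  nlinarith


end Summit.QuantumFields.BalabanUV.T4Continuum.NE7K1LinStripClassKLConsts

end
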